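import Literature.RingTheory.MvPolynomial.ConeBezoutCount
import Literature.NumberTheory.Transcendental.TorusConeDimension
import Mathlib.RingTheory.Nullstellensatz
import HarnessLib

/-!
# The torus `(Kˣ)ⁿ` acting on `K[X_1, …, X_n]` by scaling the variables; relevant primes

Topic: `Literature/NumberTheory/Transcendental` (support for the proof of the zero estimate on
`𝔾ₘ^d`, `TorusZeroEstimate.lean`). For `g ∈ (Kˣ)ⁿ` the `K`-algebra endomorphism
`ρ_g : X_i ↦ g_i X_i` of `S = K[X_1, …, X_n]` (written `MvPolynomial.aeval (fun i ↦ C g_i * X i)`,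
no new definition) satisfies `(ρ_g f)(x) = f(g • x)`; it is an automorphism (`ρ_g ∘ ρ_h = ρ_{gh}`),
acts diagonally on monomials (`coeff_scale`), hence preserves degrees and homogeneity, and
transports vanishing ideals of translates: `I(g • V) = ρ_g⁻¹ I(V)` (`vanishingIdeal_smul_eq_comap`),
preserving Krull dimensions (`ringKrullDim_quotient_comap_scale`). This is the (elementary) form in
which "translations on `G` are isomorphisms of the underlying algebraic set" (Nesterenko–Philippon
(eds.), LNM 1752, Ch. 11, proof of Prop. 2.2 and of Thm. 4.1) is used on the torus.

A prime `𝔭 ⊆ S` is RELEVANT (to the torus `U = {x | ∀ i, x_i ≠ 0}`) if it contains no variable.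
Over an algebraically closed field: `vanishingIdeal_zeroLocus_inter_torus` — `I(Z(𝔭) ∩ U) = 𝔭` for
a relevant prime (Nullstellensatz), so `Z(𝔭)` meets `U`; `forall_X_notMem_of_mem_minimalPrimes_vanishingIdeal`
— the minimal primes of `I(X)` for `X ⊆ U` are relevant; `mem_minimalPrimes_of_ringKrullDim_eq` — a
prime over `I` of the same dimension as `S/I` is a minimal prime of `I`.

## References

* Yu. V. Nesterenko, P. Philippon (eds.), *Introduction to Algebraic Independence Theory*,
  LNM 1752 (2001), Ch. 11 (D. Roy), §2.1 Example and Thm. 4.1. [NesterenkoPhilippon2001]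
-/

noncomputable section

open MvPolynomial

namespace Literature.NumberTheory.Transcendental

variable {K : Type*} [Field K] {n : ℕ}

local notation "ρ[" g "]" =>
  (MvPolynomial.aeval (R := K) (S₁ := MvPolynomial (Fin n) K)
    (fun i : Fin n => MvPolynomial.C (((g : Fin n → Kˣ) i : Kˣ) : K) * MvPolynomial.X i))

/-! ## The scaling endomorphisms `ρ_g : X_i ↦ g_i X_i` -/

/-- `ρ_g X_i = g_i X_i`. [folklore] -/
theorem scale_X (g : Fin n → Kˣ) (i : Fin n) :
    ρ[g] (X i) = C ((g i : Kˣ) : K) * X i := by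
  rw [aeval_X]

/-- **`(ρ_g f)(x) = f(g • x)`**: scaling the variables is evaluating at the scaled point.
[folklore] -/
theorem aeval_scale (g : Fin n → Kˣ) (f : MvPolynomial (Fin n) K) (x : Fin n → K) :
    MvPolynomial.aeval x (ρ[g] f) = MvPolynomial.aeval (g • x) f := by
  rw [← AlgHom.comp_apply, MvPolynomial.comp_aeval]
  have : (fun i => MvPolynomial.aeval x (C ((g i : Kˣ) : K) * X i)) = g • x := by
    funext i
    simp [Units.smul_def]
  rw [this]

/-- `ρ_g` on monomials: `ρ_g (c X^a) = (c g^a) X^a`. [folklore] -/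
theorem scale_monomial (g : Fin n → Kˣ) (a : Fin n →₀ ℕ) (c : K) :
    ρ[g] (monomial a c) = monomial a (c * ∏ i, ((g i : Kˣ) : K) ^ (a i)) := by
  rw [aeval_monomial, Finsupp.prod_fintype _ _ (fun i => by rw [pow_zero]), monomial_eq,
    Finsupp.prod_fintype _ _ (fun i => by rw [pow_zero])]
  simp_rw [mul_pow, ← map_pow]
  rw [Finset.prod_mul_distrib, ← map_prod, map_mul, Algebra.algebraMap_eq_smul_one, smul_mul_assoc,
    one_mul, MvPolynomial.smul_eq_C_mul, ← mul_assoc]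

/-- **`ρ_g` is diagonal on monomials**: `coeff_m (ρ_g f) = g^m · coeff_m f`. [folklore] -/
theorem coeff_scale (g : Fin n → Kˣ) (f : MvPolynomial (Fin n) K) (m : Fin n →₀ ℕ) :
    coeff m (ρ[g] f) = (∏ i, ((g i : Kˣ) : K) ^ (m i)) * coeff m f := by
  classical
  induction f using MvPolynomial.induction_on' with
  | monomial a c =>
    rw [scale_monomial, coeff_monomial, coeff_monomial]
    split_ifs with h
    · subst h; ring
    · rw [mul_zero]
  | add p q hp hq => rw [map_add, coeff_add, coeff_add, hp, hq, mul_add]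

/-- `ρ_g` does not enlarge the support. [folklore] -/
theorem support_scale_subset (g : Fin n → Kˣ) (f : MvPolynomial (Fin n) K) :
    (ρ[g] f).support ⊆ f.support := by
  intro m hm
  rw [mem_support_iff, coeff_scale] at hm
  rw [mem_support_iff]
  exact fun h => hm (by rw [h, mul_zero])

/-- `ρ_g` preserves homogeneity. [folklore] -/
theorem isHomogeneous_scale (g : Fin n → Kˣ) {f : MvPolynomial (Fin n) K} {k : ℕ}
    (hf : f.IsHomogeneous k) : (ρ[g] f).IsHomogeneous k := by
  intro m hm
  refine hf ?_
  rw [coeff_scale] at hm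
  exact fun h => hm (by rw [h, mul_zero])

/-- `ρ_g` does not raise the total degree. [folklore] -/
theorem totalDegree_scale_le (g : Fin n → Kˣ) (f : MvPolynomial (Fin n) K) :
    (ρ[g] f).totalDegree ≤ f.totalDegree :=
  Finset.sup_mono (support_scale_subset g f)

/-- **`ρ_g ∘ ρ_h = ρ_{gh}`** (the torus is commutative). [folklore] -/
theorem scale_scale (g h : Fin n → Kˣ) (f : MvPolynomial (Fin n) K) :
    ρ[g] (ρ[h] f) = ρ[g * h] f := by
  rw [← AlgHom.comp_apply]
  congr 1
  apply MvPolynomial.algHom_ext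
  intro i
  rw [AlgHom.comp_apply, aeval_X, map_mul, aeval_C, algebraMap_eq, aeval_X, aeval_X, ← mul_assoc,
    ← map_mul, Pi.mul_apply, Units.val_mul, mul_comm ((h i : Kˣ) : K)]

/-- `ρ_1 = id`. [folklore] -/
theorem scale_one (f : MvPolynomial (Fin n) K) : ρ[(1 : Fin n → Kˣ)] f = f := by
  have : (fun i : Fin n => C (((1 : Fin n → Kˣ) i : Kˣ) : K) * X i) = X := by
    funext i
    simp
  rw [this, MvPolynomial.aeval_X_left_apply]

/-- `ρ_g` is bijective, with inverse `ρ_{g⁻¹}`. [folklore] -/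
theorem scale_bijective (g : Fin n → Kˣ) : Function.Bijective ρ[g] := by
  refine ⟨fun f f' h => ?_, fun f => ⟨ρ[g⁻¹] f, by rw [scale_scale, mul_inv_cancel, scale_one]⟩⟩
  have := congrArg ρ[g⁻¹] h
  rwa [scale_scale, scale_scale, inv_mul_cancel, scale_one, scale_one] at this

/-! ## Translates of point sets and their vanishing ideals -/

/-- **`I(g • V) = ρ_g⁻¹(I(V))`**: a polynomial vanishes on the translate `g • V` iff its scaling
`ρ_g f` vanishes on `V`. [folklore] -/
theorem vanishingIdeal_smul_eq_comap (g : Fin n → Kˣ) (V : Set (Fin n → K)) :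
    vanishingIdeal K ((g • ·) '' V) = (vanishingIdeal K V).comap ρ[g] := by
  ext f
  simp only [Ideal.mem_comap, mem_vanishingIdeal_iff, Set.forall_mem_image, aeval_scale]

/-- The quotient by `ρ_g⁻¹ 𝔭` is isomorphic to the quotient by `𝔭`, so the Krull dimensions agree.
[folklore] -/
theorem ringKrullDim_quotient_comap_scale (g : Fin n → Kˣ) (𝔭 : Ideal (MvPolynomial (Fin n) K)) :
    ringKrullDim (MvPolynomial (Fin n) K ⧸ 𝔭.comap ρ[g]) =
      ringKrullDim (MvPolynomial (Fin n) K ⧸ 𝔭) := by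
  let e : MvPolynomial (Fin n) K ≃+* MvPolynomial (Fin n) K :=
    RingEquiv.ofBijective (ρ[g] : MvPolynomial (Fin n) K →+* MvPolynomial (Fin n) K) (scale_bijective g)
  refine ringKrullDim_eq_of_ringEquiv (Ideal.quotientEquiv _ _ e ?_)
  have hc : Ideal.comap ρ[g] 𝔭 = Ideal.comap (e : MvPolynomial (Fin n) K →+* MvPolynomial (Fin n) K) 𝔭 :=
    Ideal.ext fun _ => Iff.rfl
  rw [hc]
  exact (Ideal.map_comap_of_surjective _ e.surjective 𝔭).symm

/-- Minimal primes are transported: `𝔮` is a minimal prime of `I` iff `ρ_g⁻¹ 𝔮` is one of `ρ_g⁻¹ I`.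
[folklore] -/
theorem comap_scale_mem_minimalPrimes_iff (g : Fin n → Kˣ) {I 𝔮 : Ideal (MvPolynomial (Fin n) K)} :
    𝔮.comap ρ[g] ∈ (I.comap ρ[g]).minimalPrimes ↔ 𝔮 ∈ I.minimalPrimes := by
  rw [← Ideal.comap_coe (ρ[g]) 𝔮, ← Ideal.comap_coe (ρ[g]) I,
    Ideal.comap_minimalPrimes_eq_of_surjective
      (f := (ρ[g] : MvPolynomial (Fin n) K →+* MvPolynomial (Fin n) K)) (scale_bijective g).2]
  constructor
  · rintro ⟨𝔮', h𝔮', heq⟩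
    have : 𝔮' = 𝔮 := Ideal.comap_injective_of_surjective _ (scale_bijective g).2 heq
    exact this ▸ h𝔮'
  · intro h
    exact ⟨𝔮, h, rfl⟩

/-! ## Relevant primes and the torus `U = {x | ∀ i, x_i ≠ 0}` -/

/-- A relevant prime contains no product of the variables. [folklore] -/
theorem prod_X_notMem {𝔭 : Ideal (MvPolynomial (Fin n) K)} [𝔭.IsPrime]
    (h : ∀ i, (X i : MvPolynomial (Fin n) K) ∉ 𝔭) : (∏ i, X i : MvPolynomial (Fin n) K) ∉ 𝔭 := by
  rw [Ideal.IsPrime.prod_mem_iff]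
  push Not
  exact fun i _ => h i

/-- `∏ x_i` vanishes off the torus. [folklore] -/
theorem aeval_prod_X_eq_zero_of_not {x : Fin n → K} (hx : ¬ ∀ i, x i ≠ 0) :
    MvPolynomial.aeval x (∏ i, X i : MvPolynomial (Fin n) K) = 0 := by
  push Not at hx
  obtain ⟨i, hi⟩ := hx
  rw [map_prod]
  exact Finset.prod_eq_zero (Finset.mem_univ i) (by rw [aeval_X, hi])

/-- **`I(Z(𝔭) ∩ U) = 𝔭` for a relevant prime `𝔭`** over an algebraically closed field: if `f`
vanishes on the torus points of `Z(𝔭)` then `f · ∏ X_i` vanishes on `Z(𝔭)`, so lies in `𝔭` by the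
Nullstellensatz. [folklore] -/
theorem vanishingIdeal_zeroLocus_inter_torus [IsAlgClosed K] {𝔭 : Ideal (MvPolynomial (Fin n) K)}
    [𝔭.IsPrime] (h : ∀ i, (X i : MvPolynomial (Fin n) K) ∉ 𝔭) :
    vanishingIdeal K (zeroLocus K 𝔭 ∩ {x | ∀ i, x i ≠ 0}) = 𝔭 := by
  refine le_antisymm ?_ ?_
  · intro f hf
    have hprod : f * ∏ i, X i ∈ vanishingIdeal K (zeroLocus K 𝔭) := by
      rw [mem_vanishingIdeal_iff]
      intro x hx
      rw [map_mul]
      by_cases hU : ∀ i, x i ≠ 0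
      · rw [(mem_vanishingIdeal_iff.mp hf) x ⟨hx, hU⟩, zero_mul]
      · rw [aeval_prod_X_eq_zero_of_not hU, mul_zero]
    rw [MvPolynomial.IsPrime.vanishingIdeal_zeroLocus 𝔭] at hprod
    exact ((‹𝔭.IsPrime›).mem_or_mem hprod).resolve_right (prod_X_notMem h)
  · exact (le_vanishingIdeal_zeroLocus 𝔭).trans (vanishingIdeal_anti_mono Set.inter_subset_left)

/-- **A relevant prime has a torus point**: `Z(𝔭) ∩ U ≠ ∅`. [folklore] -/
theorem zeroLocus_inter_torus_nonempty [IsAlgClosed K] {𝔭 : Ideal (MvPolynomial (Fin n) K)}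
    [𝔭.IsPrime] (h : ∀ i, (X i : MvPolynomial (Fin n) K) ∉ 𝔭) :
    (zeroLocus K 𝔭 ∩ {x : Fin n → K | ∀ i, x i ≠ 0}).Nonempty := by
  by_contra hne
  rw [Set.not_nonempty_iff_eq_empty] at hne
  have := vanishingIdeal_zeroLocus_inter_torus h
  rw [hne, vanishingIdeal_empty] at this
  exact (‹𝔭.IsPrime›).ne_top this.symm

/-- **Minimal primes of `I(V)` for `V` inside the torus are relevant**: if `X_i ∈ 𝔭₀` then,
choosing `f` in the other minimal primes but not in `𝔭₀`, `f · X_i ∈ I(V)`, so `f` vanishes on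
`V ⊆ U`, i.e. `f ∈ I(V) ⊆ 𝔭₀` — a contradiction. [folklore] -/
theorem forall_X_notMem_of_mem_minimalPrimes_vanishingIdeal {V : Set (Fin n → K)}
    (hV : V ⊆ {x | ∀ i, x i ≠ 0}) {𝔭 : Ideal (MvPolynomial (Fin n) K)}
    (h𝔭 : 𝔭 ∈ (vanishingIdeal K V).minimalPrimes) (i : Fin n) :
    (X i : MvPolynomial (Fin n) K) ∉ 𝔭 := by
  classical
  intro hXi
  haveI : 𝔭.IsPrime := h𝔭.1.1
  -- the other minimal primes
  let 𝓠 := ((Ideal.finite_minimalPrimes_of_isNoetherianRing _ (vanishingIdeal K V)).toFinset).erase 𝔭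
  have h𝓠 : ∀ 𝔮 ∈ 𝓠, 𝔮 ∈ (vanishingIdeal K V).minimalPrimes ∧ 𝔮 ≠ 𝔭 := fun 𝔮 h𝔮 => by
    rw [Finset.mem_erase, Set.Finite.mem_toFinset] at h𝔮
    exact ⟨h𝔮.2, h𝔮.1⟩
  have hnle : ¬ 𝓠.inf id ≤ 𝔭 := by
    intro hle
    obtain ⟨𝔮, h𝔮, h𝔮le⟩ := (Ideal.IsPrime.inf_le' ‹𝔭.IsPrime›).mp hle
    obtain ⟨h𝔮min, hne⟩ := h𝓠 𝔮 h𝔮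
    exact hne (le_antisymm h𝔮le (h𝔭.2 h𝔮min.1 h𝔮le))
  obtain ⟨f, hf𝓠, hf𝔭⟩ := Set.not_subset.mp hnle
  -- `f · X_i` lies in every minimal prime, hence in the radical ideal `I(X)`
  have hmem : f * X i ∈ vanishingIdeal K V := by
    rw [← (isRadical_vanishingIdeal V).radical, ← Ideal.sInf_minimalPrimes, Ideal.mem_sInf]
    intro 𝔮 h𝔮
    by_cases heq : 𝔮 = 𝔭
    · subst heq; exact Ideal.mul_mem_left _ _ hXi
    · have : 𝔮 ∈ 𝓠 := by
        rw [Finset.mem_erase, Set.Finite.mem_toFinset]; exact ⟨heq, h𝔮⟩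
      have hf𝔮 : f ∈ 𝔮 := (Finset.inf_le this : 𝓠.inf id ≤ 𝔮) hf𝓠
      exact Ideal.mul_mem_right _ _ hf𝔮
  -- so `f` vanishes on `V ⊆ U`
  have hf : f ∈ vanishingIdeal K V := by
    rw [mem_vanishingIdeal_iff] at hmem ⊢
    intro x hx
    have := hmem x hx
    rw [map_mul, aeval_X, mul_eq_zero] at this
    exact this.resolve_right (hV hx i)
  exact hf𝔭 (h𝔭.1.2 hf)

/-- **A prime over `I` of the same (finite) dimension as `S/I` is a minimal prime of `I`.**
[folklore] -/
theorem mem_minimalPrimes_of_ringKrullDim_eq {R : Type*} [CommRing R] {I 𝔭 : Ideal R} [𝔭.IsPrime]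
    (hle : I ≤ 𝔭) {k : ℕ} (hI : ringKrullDim (R ⧸ I) = k) (h𝔭 : ringKrullDim (R ⧸ 𝔭) = k) :
    𝔭 ∈ I.minimalPrimes := by
  obtain ⟨𝔮, h𝔮, h𝔮le⟩ := Ideal.exists_minimalPrimes_le hle
  haveI : 𝔮.IsPrime := h𝔮.1.1
  have hge : ringKrullDim (R ⧸ 𝔭) ≤ ringKrullDim (R ⧸ 𝔮) :=
    ringKrullDim_le_of_surjective (Ideal.Quotient.factor h𝔮le) (Ideal.Quotient.factor_surjective _)
  have hle' : ringKrullDim (R ⧸ 𝔮) ≤ ringKrullDim (R ⧸ I) :=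
    ringKrullDim_le_of_surjective (Ideal.Quotient.factor h𝔮.1.2) (Ideal.Quotient.factor_surjective _)
  rw [h𝔭] at hge
  rw [hI] at hle'
  have h𝔮dim : ringKrullDim (R ⧸ 𝔮) = k := le_antisymm hle' hge
  rwa [← Literature.RingTheory.MvPolynomial.eq_of_le_of_ringKrullDim_quotient_eq h𝔮le h𝔮dim h𝔭]

end Literature.NumberTheory.Transcendental

end
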